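import Literature.Probability.RandomPlanarGeometry.HexSAWBrickWallStripFugacityLevel0
import Mathlib.Analysis.MeanInequalities
import HarnessLib

/-!
# Honeycomb strips with the PRINTED surface fugacity: `μ_T(y,1)` is non-decreasing in `y`, continuous, and log-convex in
# `log y` (BBdGDCG14 Proposition 6, the qualitative clauses, for the one-level weight)

Topic `Literature/Probability/RandomPlanarGeometry` (lane «pcv-sawmu», a-idea-1 gen 22; rider on
`HexSAWBrickWallStripFugacityLevel0.lean` (`HexBW.bottomVisits₀`, `HexBW.stripZ₀ = C_{T,n}(y,1)`, `HexBW.stripMuY₀ = μ_T(y,1)`,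
`HexBW.tendsto_stripZ₀_rpow`, `HexBW.bottomVisits₀_le`)).
Source: N. R. Beaton, M. Bousquet-Mélou, J. de Gier, H. Duminil-Copin, A. J. Guttmann, *The critical fugacity for surface
adsorption of self-avoiding walks on the honeycomb lattice is `1 + √2`*, Comm. Math. Phys. 326 (2014), arXiv:1109.0358v5,
§3.2 Proposition 6 (arXiv v5 p. 10): "`μ_T(y,z)` is finite, and non-decreasing in `y` and `z` … Finally, `μ_T(1,y)` is a
log-convex and thus continuous function of `log(y)`" (proof p. 11, by reference: the limits "as given in … [JvROW06]", "The
log-convexity result is easily adapted from [JvROW06]" — [JvROW06] = E. J. Janse van Rensburg, E. Orlandini, S. G. Whittington,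
J. Phys. A 39 (2006) 13869, cited here only as reported by BBdGDCG14 p. 11, not held); the proofs BELOW are the standard
termwise-monotonicity / Hölder arguments in the manner of J. M. Hammersley, G. M. Torrie, S. G. Whittington, J. Phys. A 15
(1982) 539, §2 (monotonicity, `μ(y') ≤ (y'/y) μ(y)`, log-convexity by Hölder; the equation numbers (2.10)–(2.12) used in the
tags below are as reported, unverified — HTW82 is not held).

## What is proved (every `T`, the PRINTED one-level weight of `HexSAWBrickWallStripFugacityLevel0.lean`)

* `HexBW.stripMuY₀_mono_y` — `0 < y ≤ y' ⇒ μ_T(y,1) ≤ μ_T(y',1)` ("non-decreasing in `y`");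
* `HexBW.stripMuY₀_le_div_mul` — `μ_T(y',1) ≤ (y'/y) · μ_T(y,1)` for `0 < y ≤ y'` (from `bc(ω) ≤ n + 1`), whence
  **`HexBW.continuousOn_stripMuY₀`** — `y ↦ μ_T(y,1)` is continuous on `(0, ∞)`;
* `HexBW.stripZ₀_rpow_mul_rpow_le` — Hölder on `C_{T,n}`: `C_{T,n}(y₁^θ y₂^{1-θ},1) ≤ C_{T,n}(y₁,1)^θ C_{T,n}(y₂,1)^{1-θ}`,
  whence `HexBW.stripMuY₀_rpow_mul_rpow_le` and **`HexBW.convexOn_log_stripMuY₀_exp`** — `t ↦ log μ_T(eᵗ,1)` is convex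
  on `ℝ` ("log-convex function of `log y`"); midpoint form `HexBW.stripMuY₀_sqrt_mul_sq_le`.

Used downstream (BBdGDCG14 Corollary 8, arXiv v5 p. 12): continuity of `ρ_T = 1/μ_T` for the intermediate value theorem and
log-convexity for the uniqueness of `y_T`.  The symmetry `μ_T(y,z) = μ_T(z,y)` and the `z`-clauses are not formalised here
(the tree's strip objects carry one fugacity).
-/

noncomputable section

open Filter Finset
open _root_.Topology
open Literature.Probability.LatticeModels

namespace Literature.Probability.RandomPlanarGeometry.SAW.HexBW

variable {y y₁ y₂ θ : ℝ}

/-! ### Monotonicity in `y` -/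

/-- `C_{T,n}(y,1)` is non-decreasing in `y ≥ 0`. [cite: BeatonBousquetMelouDeGierDuminilCopinGuttmann2014, Proposition 6 (arXiv v5 p. 10: "non-decreasing in y")] -/
theorem stripZ₀_mono_y (T n : ℕ) (hy : 0 ≤ y) {y' : ℝ} (hyy' : y ≤ y') : stripZ₀ T n y ≤ stripZ₀ T n y' :=
  Finset.sum_le_sum fun _ _ => pow_le_pow_left₀ hy hyy' _

/-- `C_{T,n}(y,1) ≥ 0` for `y ≥ 0` (a sum of non-negative monomials).
[cite: BeatonBousquetMelouDeGierDuminilCopinGuttmann2014, §3.2 (arXiv v5 p. 10: C_{T,k}(y,z) = Σ_{|ω|=k} y^{bc(ω)} z^{tc(ω)}); lane plumbing, not in print] -/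
theorem stripZ₀_nonneg (T n : ℕ) (hy : 0 ≤ y) : 0 ≤ stripZ₀ T n y := Finset.sum_nonneg fun _ _ => pow_nonneg hy _

/-- **`μ_T(y,1)` is non-decreasing in `y > 0`.** [cite: BeatonBousquetMelouDeGierDuminilCopinGuttmann2014, Proposition 6 (arXiv v5 p. 10: "μ_T(y,z) is … non-decreasing in y and z")] -/
theorem stripMuY₀_mono_y (T : ℕ) (hy : 0 < y) {y' : ℝ} (hyy' : y ≤ y') : stripMuY₀ T y ≤ stripMuY₀ T y' :=
  le_of_tendsto_of_tendsto' (tendsto_stripZ₀_rpow T hy) (tendsto_stripZ₀_rpow T (hy.trans_le hyy')) fun n =>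
    Real.rpow_le_rpow (stripZ₀_nonneg T n hy.le) (stripZ₀_mono_y T n hy.le hyy') (by positivity)

/-- `μ_T(·,1)` is monotone on `(0, ∞)`. [cite: BeatonBousquetMelouDeGierDuminilCopinGuttmann2014, Proposition 6 (arXiv v5 p. 10)] -/
theorem monotoneOn_stripMuY₀ (T : ℕ) : MonotoneOn (stripMuY₀ T) (Set.Ioi 0) := fun _ hy _ _ hyy' =>
  stripMuY₀_mono_y T hy hyy'

/-! ### `μ_T(y',1) ≤ (y'/y) μ_T(y,1)` and continuity -/

/-- `C_{T,n}(y',1) ≤ (y'/y)^{n+1} C_{T,n}(y,1)` for `0 < y ≤ y'` (every walk has `bc ≤ n + 1`).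
[cite: HammersleyTorrieWhittington1982, §2 (2.10)–(2.11)] -/
theorem stripZ₀_le_pow_mul (T n : ℕ) (hy : 0 < y) {y' : ℝ} (hyy' : y ≤ y') :
    stripZ₀ T n y' ≤ (y' / y) ^ (n + 1) * stripZ₀ T n y := by
  have hq : 1 ≤ y' / y := (one_le_div hy).2 hyy'
  rw [stripZ₀, stripZ₀, Finset.mul_sum]
  refine Finset.sum_le_sum fun p _ => ?_
  have hb := bottomVisits₀_le p.1 p.2 n
  calc y' ^ bottomVisits₀ p.1 p.2 n = (y' / y) ^ bottomVisits₀ p.1 p.2 n * y ^ bottomVisits₀ p.1 p.2 n := by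
        rw [← mul_pow, div_mul_cancel₀ _ hy.ne']
    _ ≤ (y' / y) ^ (n + 1) * y ^ bottomVisits₀ p.1 p.2 n :=
        mul_le_mul_of_nonneg_right (pow_le_pow_right₀ hq hb) (pow_nonneg hy.le _)

/-- `q^{(n+1)/n} → q` for `q > 0`. [cite: MadrasSlade1993, §1.2 (n-th roots)] -/
theorem tendsto_rpow_succ_div {q : ℝ} (hq : 0 < q) :
    Tendsto (fun n : ℕ => q ^ (((n : ℝ) + 1) * (1 / (n : ℝ)))) atTop (𝓝 q) := by
  have he : Tendsto (fun n : ℕ => ((n : ℝ) + 1) * (1 / (n : ℝ))) atTop (𝓝 1) := by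
    have h1 : Tendsto (fun n : ℕ => 1 + 1 / (n : ℝ)) atTop (𝓝 (1 + 0)) :=
      tendsto_const_nhds.add tendsto_one_div_atTop_nhds_zero_nat
    rw [add_zero] at h1
    refine h1.congr' ?_
    filter_upwards [Filter.eventually_ge_atTop 1] with n hn
    have hn' : (n : ℝ) ≠ 0 := by positivity
    field_simp
  have h := ((Real.continuousAt_const_rpow hq.ne').tendsto).comp he
  rwa [Function.comp_def, Real.rpow_one] at h

/-- **`μ_T(y',1) ≤ (y'/y) · μ_T(y,1)` for `0 < y ≤ y'`.** [cite: HammersleyTorrieWhittington1982, §2 (2.11); BeatonBousquetMelouDeGierDuminilCopinGuttmann2014, Proposition 6 (arXiv v5 p. 10)] -/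
theorem stripMuY₀_le_div_mul (T : ℕ) (hy : 0 < y) {y' : ℝ} (hyy' : y ≤ y') :
    stripMuY₀ T y' ≤ y' / y * stripMuY₀ T y := by
  have hy' : 0 < y' := hy.trans_le hyy'
  have hq : 0 < y' / y := div_pos hy' hy
  refine le_of_tendsto_of_tendsto' (tendsto_stripZ₀_rpow T hy') ((tendsto_rpow_succ_div hq).mul (tendsto_stripZ₀_rpow T hy))
    fun n => ?_
  have hZ := stripZ₀_nonneg T n hy.le
  calc stripZ₀ T n y' ^ (1 / (n : ℝ)) ≤ ((y' / y) ^ (n + 1) * stripZ₀ T n y) ^ (1 / (n : ℝ)) :=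
        Real.rpow_le_rpow (stripZ₀_nonneg T n hy'.le) (stripZ₀_le_pow_mul T n hy hyy') (by positivity)
    _ = (y' / y) ^ (((n : ℝ) + 1) * (1 / (n : ℝ))) * stripZ₀ T n y ^ (1 / (n : ℝ)) := by
        rw [Real.mul_rpow (pow_nonneg hq.le _) hZ, Real.rpow_mul hq.le, ← Nat.cast_add_one, Real.rpow_natCast]

/-- **`y ↦ μ_T(y,1)` is continuous on `(0, ∞)`** (monotone with `μ_T(y,1)/y` non-increasing).
[cite: BeatonBousquetMelouDeGierDuminilCopinGuttmann2014, Proposition 6 (arXiv v5 p. 10: "and thus continuous"); HammersleyTorrieWhittington1982, §2 (2.12)] -/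
theorem continuousOn_stripMuY₀ (T : ℕ) : ContinuousOn (stripMuY₀ T) (Set.Ioi 0) := by
  rw [Metric.continuousOn_iff]
  intro y₀ hy₀ ε hε
  have hy₀' : (0 : ℝ) < y₀ := hy₀
  have hM : 0 < stripMuY₀ T y₀ := stripMuY₀_pos T hy₀'
  set M := stripMuY₀ T y₀ with hMdef
  have hy0ne : y₀ ≠ 0 := hy₀'.ne'
  have hMne : M ≠ 0 := hM.ne'
  refine ⟨min (y₀ / 2) (ε * y₀ / (4 * M)), lt_min (by linarith) (by positivity), fun y hy hd => ?_⟩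
  have hy' : (0 : ℝ) < y := hy
  have hyne : y ≠ 0 := hy'.ne'
  rw [Real.dist_eq] at hd ⊢
  have hd1 : |y - y₀| < y₀ / 2 := lt_of_lt_of_le hd (min_le_left _ _)
  have hd2 : |y - y₀| < ε * y₀ / (4 * M) := lt_of_lt_of_le hd (min_le_right _ _)
  rw [abs_sub_lt_iff] at hd1 hd2 ⊢
  rcases le_or_gt y₀ y with hle | hlt
  · have h1 := stripMuY₀_mono_y T hy₀' hle
    have h2 := stripMuY₀_le_div_mul T hy₀' hle
    have e : y / y₀ * M - M = (y - y₀) / y₀ * M := by rw [sub_div, div_self hy0ne]; ring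
    constructor
    · calc stripMuY₀ T y - M ≤ (y - y₀) / y₀ * M := by linarith [h2, e]
        _ ≤ (ε * y₀ / (4 * M)) / y₀ * M := mul_le_mul_of_nonneg_right (div_le_div_of_nonneg_right hd2.1.le hy₀'.le) hM.le
        _ = ε / 4 := by field_simp
        _ < ε := by linarith
    · linarith [h1]
  · have hle := hlt.le
    have h1 := stripMuY₀_mono_y T hy' hle
    have h2 := stripMuY₀_le_div_mul T hy' hle
    have hy2 : y₀ / 2 < y := by linarith [hd1.2]
    have e : y₀ / y * stripMuY₀ T y - stripMuY₀ T y = (y₀ - y) / y * stripMuY₀ T y := by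
      rw [sub_div, div_self hyne]; ring
    constructor
    · linarith [h1]
    · have h3 : M - stripMuY₀ T y ≤ (y₀ - y) / y * stripMuY₀ T y := by linarith [h2, e]
      have h4 : (y₀ - y) / y * stripMuY₀ T y ≤ (y₀ - y) / y * M :=
        mul_le_mul_of_nonneg_left h1 (div_nonneg (by linarith) hy'.le)
      have h5 : (y₀ - y) / y < ε / (2 * M) := by
        rw [div_lt_iff₀ hy']
        calc y₀ - y < ε * y₀ / (4 * M) := hd2.2
          _ = ε / (2 * M) * (y₀ / 2) := by field_simp; ring
          _ < ε / (2 * M) * y := mul_lt_mul_of_pos_left hy2 (by positivity)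
      calc M - stripMuY₀ T y ≤ (y₀ - y) / y * M := h3.trans h4
        _ < ε / (2 * M) * M := mul_lt_mul_of_pos_right h5 hM
        _ = ε / 2 := by field_simp
        _ < ε := by linarith

/-- Continuity at every `y > 0`. [cite: BeatonBousquetMelouDeGierDuminilCopinGuttmann2014, Proposition 6 (arXiv v5 p. 10)] -/
theorem continuousAt_stripMuY₀ (T : ℕ) (hy : 0 < y) : ContinuousAt (stripMuY₀ T) y :=
  (continuousOn_stripMuY₀ T).continuousAt (Ioi_mem_nhds hy)

/-! ### Log-convexity in `log y` (Cauchy–Schwarz / Hölder on `C_{T,n}(y,1)`) -/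

/-- Cauchy–Schwarz on the strip walks: `C_{T,n}(√(y₁y₂),1)² ≤ C_{T,n}(y₁,1) · C_{T,n}(y₂,1)`.
[cite: HammersleyTorrieWhittington1982, §2 (2.12); BeatonBousquetMelouDeGierDuminilCopinGuttmann2014, Proposition 6 (arXiv v5 p. 10: "log-convex")] -/
theorem stripZ₀_sqrt_mul_sq_le (T n : ℕ) (hy₁ : 0 ≤ y₁) (hy₂ : 0 ≤ y₂) :
    stripZ₀ T n (Real.sqrt (y₁ * y₂)) ^ 2 ≤ stripZ₀ T n y₁ * stripZ₀ T n y₂ := by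
  have key := Finset.sum_mul_sq_le_sq_mul_sq (stripPairs T n)
    (fun p => Real.sqrt y₁ ^ bottomVisits₀ p.1 p.2 n) (fun p => Real.sqrt y₂ ^ bottomVisits₀ p.1 p.2 n)
  have e : ∀ p : Site 2 × (ℕ → Site 2), Real.sqrt (y₁ * y₂) ^ bottomVisits₀ p.1 p.2 n =
      Real.sqrt y₁ ^ bottomVisits₀ p.1 p.2 n * Real.sqrt y₂ ^ bottomVisits₀ p.1 p.2 n := fun p => by
    rw [Real.sqrt_mul hy₁, mul_pow]
  have e1 : ∀ p : Site 2 × (ℕ → Site 2), (Real.sqrt y₁ ^ bottomVisits₀ p.1 p.2 n) ^ 2 = y₁ ^ bottomVisits₀ p.1 p.2 n :=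
    fun p => by rw [← pow_mul, mul_comm, pow_mul, Real.sq_sqrt hy₁]
  have e2 : ∀ p : Site 2 × (ℕ → Site 2), (Real.sqrt y₂ ^ bottomVisits₀ p.1 p.2 n) ^ 2 = y₂ ^ bottomVisits₀ p.1 p.2 n :=
    fun p => by rw [← pow_mul, mul_comm, pow_mul, Real.sq_sqrt hy₂]
  simp only [e1, e2] at key
  unfold stripZ₀
  simp only [e]
  exact key

/-- **`μ_T(√(y₁y₂),1)² ≤ μ_T(y₁,1) · μ_T(y₂,1)`** (midpoint log-convexity).
[cite: BeatonBousquetMelouDeGierDuminilCopinGuttmann2014, Proposition 6 (arXiv v5 p. 10: "log-convex"); HammersleyTorrieWhittington1982, §2 (2.12)] -/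
theorem stripMuY₀_sqrt_mul_sq_le (T : ℕ) (hy₁ : 0 < y₁) (hy₂ : 0 < y₂) :
    stripMuY₀ T (Real.sqrt (y₁ * y₂)) ^ 2 ≤ stripMuY₀ T y₁ * stripMuY₀ T y₂ := by
  have hs : 0 < Real.sqrt (y₁ * y₂) := Real.sqrt_pos.2 (mul_pos hy₁ hy₂)
  refine le_of_tendsto_of_tendsto' ((tendsto_stripZ₀_rpow T hs).pow 2)
    ((tendsto_stripZ₀_rpow T hy₁).mul (tendsto_stripZ₀_rpow T hy₂)) fun n => ?_
  have h0 := stripZ₀_nonneg T n hs.le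
  calc (stripZ₀ T n (Real.sqrt (y₁ * y₂)) ^ (1 / (n : ℝ))) ^ 2
      = (stripZ₀ T n (Real.sqrt (y₁ * y₂)) ^ 2) ^ (1 / (n : ℝ)) := Real.rpow_pow_comm h0 _ 2
    _ ≤ (stripZ₀ T n y₁ * stripZ₀ T n y₂) ^ (1 / (n : ℝ)) :=
        Real.rpow_le_rpow (sq_nonneg _) (stripZ₀_sqrt_mul_sq_le T n hy₁.le hy₂.le) (by positivity)
    _ = stripZ₀ T n y₁ ^ (1 / (n : ℝ)) * stripZ₀ T n y₂ ^ (1 / (n : ℝ)) :=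
        Real.mul_rpow (stripZ₀_nonneg T n hy₁.le) (stripZ₀_nonneg T n hy₂.le)

/-- Hölder on the strip walks: `C_{T,n}(y₁^θ y₂^{1−θ},1) ≤ C_{T,n}(y₁,1)^θ · C_{T,n}(y₂,1)^{1−θ}` (`0 < θ < 1`).
[cite: HammersleyTorrieWhittington1982, §2 (2.12); BeatonBousquetMelouDeGierDuminilCopinGuttmann2014, Proposition 6 (arXiv v5 p. 10: "log-convex")] -/
theorem stripZ₀_rpow_mul_rpow_le (T : ℕ) (hy₁ : 0 < y₁) (hy₂ : 0 < y₂) (hθ0 : 0 < θ) (hθ1 : θ < 1) (n : ℕ) :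
    stripZ₀ T n (y₁ ^ θ * y₂ ^ (1 - θ)) ≤ stripZ₀ T n y₁ ^ θ * stripZ₀ T n y₂ ^ (1 - θ) := by
  have hpq : θ⁻¹.HolderConjugate (1 - θ)⁻¹ := Real.HolderConjugate.inv_one_sub_inv hθ0 hθ1
  have h1θ : 0 < 1 - θ := sub_pos.2 hθ1
  unfold stripZ₀
  have key := Real.inner_le_Lp_mul_Lq_of_nonneg (stripPairs T n) hpq
      (f := fun p => (y₁ ^ bottomVisits₀ p.1 p.2 n) ^ θ) (g := fun p => (y₂ ^ bottomVisits₀ p.1 p.2 n) ^ (1 - θ))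
      (fun p _ => by positivity) (fun p _ => by positivity)
  have hf : ∀ p : Site 2 × (ℕ → Site 2), ((y₁ ^ bottomVisits₀ p.1 p.2 n) ^ θ) ^ θ⁻¹ = y₁ ^ bottomVisits₀ p.1 p.2 n :=
    fun p => Real.rpow_rpow_inv (pow_nonneg hy₁.le _) hθ0.ne'
  have hg : ∀ p : Site 2 × (ℕ → Site 2), ((y₂ ^ bottomVisits₀ p.1 p.2 n) ^ (1 - θ)) ^ (1 - θ)⁻¹ =
      y₂ ^ bottomVisits₀ p.1 p.2 n := fun p => Real.rpow_rpow_inv (pow_nonneg hy₂.le _) h1θ.ne'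
  have hfg : ∀ p : Site 2 × (ℕ → Site 2), (y₁ ^ bottomVisits₀ p.1 p.2 n) ^ θ * (y₂ ^ bottomVisits₀ p.1 p.2 n) ^ (1 - θ) =
      (y₁ ^ θ * y₂ ^ (1 - θ)) ^ bottomVisits₀ p.1 p.2 n := fun p => by
    rw [mul_pow, Real.rpow_pow_comm hy₁.le, Real.rpow_pow_comm hy₂.le]
  simp only [one_div, inv_inv, hf, hg, hfg] at key
  exact key

/-- **`μ_T(y₁^θ y₂^{1−θ},1) ≤ μ_T(y₁,1)^θ · μ_T(y₂,1)^{1−θ}`** (`0 ≤ θ ≤ 1`).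
[cite: BeatonBousquetMelouDeGierDuminilCopinGuttmann2014, Proposition 6 (arXiv v5 p. 10: "a log-convex … function of log(y)"); HammersleyTorrieWhittington1982, §2 (2.12)] -/
theorem stripMuY₀_rpow_mul_rpow_le (T : ℕ) (hy₁ : 0 < y₁) (hy₂ : 0 < y₂) (hθ0 : 0 ≤ θ) (hθ1 : θ ≤ 1) :
    stripMuY₀ T (y₁ ^ θ * y₂ ^ (1 - θ)) ≤ stripMuY₀ T y₁ ^ θ * stripMuY₀ T y₂ ^ (1 - θ) := by
  rcases hθ0.eq_or_lt with rfl | hθ0'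
  · simp
  rcases hθ1.eq_or_lt with rfl | hθ1'
  · simp
  have hz : 0 < y₁ ^ θ * y₂ ^ (1 - θ) := mul_pos (Real.rpow_pos_of_pos hy₁ _) (Real.rpow_pos_of_pos hy₂ _)
  refine le_of_tendsto_of_tendsto' (tendsto_stripZ₀_rpow T hz)
    (((tendsto_stripZ₀_rpow T hy₁).rpow_const (Or.inr hθ0)).mul
      ((tendsto_stripZ₀_rpow T hy₂).rpow_const (Or.inr (sub_nonneg.2 hθ1)))) fun n => ?_
  have h := stripZ₀_rpow_mul_rpow_le T hy₁ hy₂ hθ0' hθ1' n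
  have h₁ := stripZ₀_nonneg T n hy₁.le
  have h₂ := stripZ₀_nonneg T n hy₂.le
  calc stripZ₀ T n (y₁ ^ θ * y₂ ^ (1 - θ)) ^ (1 / (n : ℝ))
      ≤ (stripZ₀ T n y₁ ^ θ * stripZ₀ T n y₂ ^ (1 - θ)) ^ (1 / (n : ℝ)) :=
        Real.rpow_le_rpow (stripZ₀_nonneg T n hz.le) h (by positivity)
    _ = (stripZ₀ T n y₁ ^ (1 / (n : ℝ))) ^ θ * (stripZ₀ T n y₂ ^ (1 / (n : ℝ))) ^ (1 - θ) := by
        rw [Real.mul_rpow (Real.rpow_nonneg h₁ _) (Real.rpow_nonneg h₂ _), ← Real.rpow_mul h₁, ← Real.rpow_mul h₂,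
          mul_comm θ, mul_comm (1 - θ), Real.rpow_mul h₁, Real.rpow_mul h₂]

/-- **Proposition 6, "a log-convex … function of `log(y)`": `t ↦ log μ_T(eᵗ,1)` is convex on `ℝ`, for every `T`.**
[cite: BeatonBousquetMelouDeGierDuminilCopinGuttmann2014, Proposition 6 (arXiv v5 p. 10: "Finally, μ_T(1,y) is a log-convex and thus continuous function of log(y)"); HammersleyTorrieWhittington1982, §2 (2.12)] -/
theorem convexOn_log_stripMuY₀_exp (T : ℕ) :
    ConvexOn ℝ Set.univ (fun t : ℝ => Real.log (stripMuY₀ T (Real.exp t))) := by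
  refine convexOn_iff_forall_pos.2 ⟨convex_univ, fun t₁ _ t₂ _ a b ha hb hab => ?_⟩
  obtain rfl : b = 1 - a := by linarith
  simp only [smul_eq_mul]
  have h1 := Real.exp_pos t₁
  have h2 := Real.exp_pos t₂
  have key := stripMuY₀_rpow_mul_rpow_le T h1 h2 ha.le (by linarith)
  have hexp : Real.exp (a * t₁ + (1 - a) * t₂) = Real.exp t₁ ^ a * Real.exp t₂ ^ (1 - a) := by
    rw [Real.exp_add, mul_comm a, mul_comm (1 - a), Real.exp_mul, Real.exp_mul]
  rw [hexp]
  have hp := fun s : ℝ => stripMuY₀_pos T (Real.exp_pos s)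
  calc Real.log (stripMuY₀ T (Real.exp t₁ ^ a * Real.exp t₂ ^ (1 - a)))
      ≤ Real.log (stripMuY₀ T (Real.exp t₁) ^ a * stripMuY₀ T (Real.exp t₂) ^ (1 - a)) :=
        Real.log_le_log (stripMuY₀_pos T (mul_pos (Real.rpow_pos_of_pos h1 _) (Real.rpow_pos_of_pos h2 _))) key
    _ = a * Real.log (stripMuY₀ T (Real.exp t₁)) + (1 - a) * Real.log (stripMuY₀ T (Real.exp t₂)) := by
        rw [Real.log_mul (Real.rpow_pos_of_pos (hp t₁) _).ne' (Real.rpow_pos_of_pos (hp t₂) _).ne',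
          Real.log_rpow (hp t₁), Real.log_rpow (hp t₂)]

/-- The same convexity read on `(0,∞)` in the variable `u = log y`: for `0 < y₁, y₂` and `0 ≤ θ ≤ 1`,
`log μ_T(y₁^θ y₂^{1-θ},1) ≤ θ log μ_T(y₁,1) + (1-θ) log μ_T(y₂,1)`.
[cite: BeatonBousquetMelouDeGierDuminilCopinGuttmann2014, Proposition 6 (arXiv v5 p. 10)] -/
theorem log_stripMuY₀_rpow_mul_rpow_le (T : ℕ) (hy₁ : 0 < y₁) (hy₂ : 0 < y₂) (hθ0 : 0 ≤ θ) (hθ1 : θ ≤ 1) :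
    Real.log (stripMuY₀ T (y₁ ^ θ * y₂ ^ (1 - θ))) ≤
      θ * Real.log (stripMuY₀ T y₁) + (1 - θ) * Real.log (stripMuY₀ T y₂) := by
  have hz : 0 < y₁ ^ θ * y₂ ^ (1 - θ) := mul_pos (Real.rpow_pos_of_pos hy₁ _) (Real.rpow_pos_of_pos hy₂ _)
  have hp₁ := stripMuY₀_pos T hy₁
  have hp₂ := stripMuY₀_pos T hy₂
  calc Real.log (stripMuY₀ T (y₁ ^ θ * y₂ ^ (1 - θ)))
      ≤ Real.log (stripMuY₀ T y₁ ^ θ * stripMuY₀ T y₂ ^ (1 - θ)) :=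
        Real.log_le_log (stripMuY₀_pos T hz) (stripMuY₀_rpow_mul_rpow_le T hy₁ hy₂ hθ0 hθ1)
    _ = θ * Real.log (stripMuY₀ T y₁) + (1 - θ) * Real.log (stripMuY₀ T y₂) := by
        rw [Real.log_mul (Real.rpow_pos_of_pos hp₁ _).ne' (Real.rpow_pos_of_pos hp₂ _).ne', Real.log_rpow hp₁,
          Real.log_rpow hp₂]

end Literature.Probability.RandomPlanarGeometry.SAW.HexBW
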